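import Summits.ResolutionOfSingularities.ResolutionOfSingularities.Theorems.EquisingularLiftEquisingularLiftNatGoodAtOfFlatModel
import Summits.ResolutionOfSingularities.ResolutionOfSingularities.Theorems.EquisingularLiftEquisingularLiftSectionKer
import HarnessLib

/-!
# [OURS · L1 W4.5(b) · EL♮(3) · card `nested-sections`, first lemma] The NESTED HENSEL SECTION: a point-step section chosen inside the
# stratum of the member models through the point
Crux chain w45b, child EL♮(3) = stmt-ResolutionOfSingularities-20148. Crux idea `nested-sections` (res-L1-w45b-idea-1 g15, triage r1 PASS 2/2;
res-L1-w45b-plan-1 RULING R16 (iii)/(iv), 2026-08-28T06:26:26Z: «ENGINE RE-CUT of `Exc₃`/`PtTransportOK` at the WALL (T23-B tier); its first lemma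
`stub_nested_section` is KERNEL-SIZED NOW … the WALL supplier stub-4's T23-B re-cut will need»). Letter = the card's `stub_nested_section`
(`Cruxes/EquisingularLiftNatThree/Sketch_L1_idea_1_g15.lean` l.129) with binders and conclusion VERBATIM, filed by res-L1-w45b-lead-1 g12.

If the stratum `ι : W ↪ X` — the scheme-theoretic intersection of the `O`-models of the retained members through the point — is `O`-flat,
separated and locally of finite presentation over `O`, regular at `j x` and with regular special fibre `F` at the CLOSED point `x`, then the
point-step section through `x` can be chosen INSIDE `W`: compose the Hensel section of `W` (tree `exists_section_of_model_of_isRegularLocalRing`,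
p527131, EGA IV 18.5.17 over a complete DVR with algebraically closed residue field) with `ι`. So every member `V(𝓕) ⊇ W` CONTAINS the new
centre, and its transport through the point step is the first alternative of the round/point clause (centre inside the member), not the WALL.

* `exists_nested_section` — the letter verbatim: `∃ s, s ≫ r = 𝟙 ∧ s(𝔪) = ι (j x) ∧ V(ker s) regular ∧ range s ⊆ range ι`;
* `exists_nested_section_closedImmersion` — the same section with what a transport consumer reads off it: `s` is a closed immersion,
  `supp (ker s) = range s`, and `s(𝔪)` is a closed point of `X` (no separatedness of `X` needed: `s = s_W ≫ ι` with `s_W` a section of the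
  separated `W → Spec O`).

Everything is proved; DEF-FREE; no `sorry`; standard axioms. OURS; NOT a statement of any manuscript; AI-written, weaker than expert review.
`--supports stmt-ResolutionOfSingularities-20148 --as helper`. [cite: Grothendieck1967, Thm. 18.5.17] (index only, through p527131).
-/

set_option linter.dupNamespace false -- mandated namespace `Summit.<Summit>.<Problem>` of this single-conjunct summit

noncomputable section

open CategoryTheory AlgebraicGeometry TopologicalSpace IsLocalRing
open Literature.AlgebraicGeometry.Resolution

namespace Summit.ResolutionOfSingularities.ResolutionOfSingularities.Cruxes.EquisingularLiftNat.Sections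

/-- **NESTED HENSEL SECTION, with the closed-immersion bookkeeping.** For a complete DVR `O` with algebraically closed residue field,
`θ : O ↠ k`, an `O`-scheme `r : X → Spec O`, a closed subscheme `ι : W ↪ X` which is flat, separated and locally of finite presentation
OVER `O`, its special fibre `F` (model square `IsPullback j t (ι ≫ r) (Spec θ)`) and a CLOSED point `x ∈ F` with `𝒪_{W, j x}` and
`𝒪_{F, x}` regular: there is a section `s` of `r` through `ι (j x)` which is a closed immersion with image inside `ι(W)`, regular centre
`V(ker s)`, `supp (ker s) = range s`, and `s(𝔪)` closed in `X`. [cite: Grothendieck1967, Thm. 18.5.17] -/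
theorem exists_nested_section_closedImmersion (O : Type) [CommRing O] [IsDomain O] [IsDiscreteValuationRing O]
    [IsAdicComplete (maximalIdeal O) O] [IsAlgClosed (ResidueField O)] (k : Type) [Field k]
    (θ : O →+* k) (hθ : Function.Surjective θ) (X W F : Scheme.{0}) (r : X ⟶ Spec (.of O)) (ι : W ⟶ X)
    [IsClosedImmersion ι] [Flat (ι ≫ r)] [IsSeparated (ι ≫ r)] [LocallyOfFinitePresentation (ι ≫ r)]
    (j : F ⟶ W) (t : F ⟶ Spec (.of k)) (hsq : IsPullback j t (ι ≫ r) (Spec.map (CommRingCat.ofHom θ))) (x : F)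
    (hxcl : IsClosed ({x} : Set F)) (hreg : IsRegularLocalRing (W.presheaf.stalk (j x)))
    (hx : IsRegularLocalRing (F.presheaf.stalk x)) :
    ∃ s : Spec (.of O) ⟶ X, s ≫ r = 𝟙 _ ∧ s (closedPoint O) = ι (j x) ∧ IsClosedImmersion s ∧
      Scheme.IsRegular s.ker.subscheme ∧ Set.range s.base ⊆ Set.range ι.base ∧
      (s.ker.support : Set X) = Set.range s.base ∧ IsClosed ({s (closedPoint O)} : Set X) := by
  -- the Hensel section of the stratum `W` through `j x`
  obtain ⟨sW, hsW, hsWx, -, -, -⟩ :=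
    exists_section_of_model_of_isRegularLocalRing O k θ hθ W F (ι ≫ r) j t hsq x hxcl hreg hx
  -- a section of the separated `W → Spec O` is a closed immersion
  obtain ⟨hsWci, -, -, -⟩ :=
    Summit.ResolutionOfSingularities.ResolutionOfSingularities.Cruxes.EquisingularLift.StrataSplit.section_isClosedImmersion_and_isRegular_ker
      O W (ι ≫ r) sW hsW
  haveI := hsWci
  haveI : IsClosedImmersion (sW ≫ ι) := inferInstance
  haveI : IsRegularRing (CommRingCat.of O) := inferInstanceAs (IsRegularRing O)
  refine ⟨sW ≫ ι, by rw [Category.assoc, hsW], by rw [Scheme.Hom.comp_apply, hsWx], inferInstance,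
    Scheme.IsRegular.of_isOpenImmersion (inv (sW ≫ ι).toImage) (Scheme.isRegular_Spec (.of O)), ?_, ?_, ?_⟩
  · rintro _ ⟨p, rfl⟩
    exact ⟨sW.base p, rfl⟩
  · rw [Scheme.Hom.support_ker, (sW ≫ ι).isClosedEmbedding.isClosed_range.closure_eq]
  · have h := (sW ≫ ι).isClosedEmbedding.isClosedMap _ (isClosed_singleton_closedPoint O)
    have e : ({(sW ≫ ι) (closedPoint O)} : Set X) = (sW ≫ ι) '' {closedPoint O} := Set.image_singleton.symm
    rw [e]
    exact h

/-- **NESTED HENSEL SECTION** — the letter of the card `nested-sections` (`stub_nested_section`, res-L1-w45b-idea-1 g15): if the stratum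
`ι : W ↪ X` of the member models through the point is `O`-flat, separated, locally of finite presentation, regular at `j x` with regular
special fibre at the closed point `x`, the point-step section through `x` can be chosen INSIDE `W`. [cite: Grothendieck1967, Thm. 18.5.17] -/
theorem exists_nested_section (O : Type) [CommRing O] [IsDomain O] [IsDiscreteValuationRing O]
    [IsAdicComplete (maximalIdeal O) O] [IsAlgClosed (ResidueField O)] (k : Type) [Field k]
    (θ : O →+* k) (hθ : Function.Surjective θ) (X W F : Scheme.{0}) (r : X ⟶ Spec (.of O)) (ι : W ⟶ X)
    [IsClosedImmersion ι] [Flat (ι ≫ r)] [IsSeparated (ι ≫ r)] [LocallyOfFinitePresentation (ι ≫ r)]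
    (j : F ⟶ W) (t : F ⟶ Spec (.of k)) (hsq : IsPullback j t (ι ≫ r) (Spec.map (CommRingCat.ofHom θ))) (x : F)
    (hxcl : IsClosed ({x} : Set F)) (hreg : IsRegularLocalRing (W.presheaf.stalk (j x)))
    (hx : IsRegularLocalRing (F.presheaf.stalk x)) :
    ∃ s : Spec (.of O) ⟶ X, s ≫ r = 𝟙 _ ∧ s (closedPoint O) = ι (j x) ∧
      Scheme.IsRegular s.ker.subscheme ∧ Set.range s.base ⊆ Set.range ι.base := by
  obtain ⟨s, hs, hsx, -, hreg', hrange, -, -⟩ :=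
    exists_nested_section_closedImmersion O k θ hθ X W F r ι j t hsq x hxcl hreg hx
  exact ⟨s, hs, hsx, hreg', hrange⟩

end Summit.ResolutionOfSingularities.ResolutionOfSingularities.Cruxes.EquisingularLiftNat.Sections

end
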